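import Summits.ResolutionOfSingularities.ResolutionOfSingularities.Theorems.FrobeniusClosingPatchingRelPerfectDepthMultiHostCJSTransportPieceRP
import Summits.ResolutionOfSingularities.ResolutionOfSingularities.Theorems.FrobeniusClosingPatchingRelPerfectDepthMultiHostCJSTransportPerm
import Literature.AlgebraicGeometry.Resolution.BlowupsLocal
import Summits.ResolutionOfSingularities.ResolutionOfSingularities.Theorems.FrobeniusClosingPatchingRelPerfectDepthMultiHostCJSTransportLoop
import HarnessLib

/-!
# Crux `PatchingRelPerfect` (stmt-ResolutionOfSingularities-16161), chain W5.2 — F7(β) (β-AX) T2b-X, module 2 (v7):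
# the JOINT PIECES LOOP over one CJS centre

[OURS · L1 W5.2 · F7(β) (β-AX) T2b-X (res-L1-w52-plan-1 CORRECTION G11-15′ (2): hand res-D-pv-054 g7)] Fact-free; def-free; the
X-side LIFT is the hypothesis `hlift` of module 1⁗ (`…DepthMultiHostCJSTransportPieceRP`: = `CylState.lift_of_open_bd`΄s conclusion universally
closed; `hP` = targets-v7 `ChainW52F7BetaRP.StepStable P` verbatim, RULING G12-1 / NOTE G12-2); the CJS data of the centre (singular-or-boundary,
permissibility, read on the carrier w.r.t. the reduced total host trace `D`) are carried to the later pieces along the earlier piece blow-ups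
(`…TransportPerm`), the total host trace as an EQUALITY `⋃ Supp tr′ = cl ρ⁻¹(D ∖ V(C₀))`, and the converse boundary link; NOT statements of the manuscript under review
(Hironaka 2017); AI-written, weaker than expert review.

* (`piece_data_transport` — from module 2 v5 `…TransportLoop`, imported.)
* `joint_centre_auxRP` — ONE CJS CENTRE (by induction on the number of pieces; callers pass `Zs.length` and `rfl`): its pieces on the carrier are blown up one after the other by `joint_piece`, the CJS blowing up
  following through `exists_fac_of_isPiecePartition_cons`; when no piece is left the remaining blowing up is along `⊤`, an isomorphism
  `e : (new carrier) ≅ (CJS stage)` (ISO-TOLERANCE, as in R5ᴴ N3 `HSepCJS.cjs_transport`).  X-side: a blowing up along ONE ideal sheaf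
  supported on the carrier (`IsBlowup.exists_isBlowup_comp_supported`), `X′` regular, `K′ = π^* K`.

## References
* V. Cossart, U. Jannsen, S. Saito, LNM 2270 (2020), Thm. 1.4, (6.2), Def. 4.1. [CossartJannsenSaito2020]
* J. Kollár, *Lectures on Resolution of Singularities* (2007), (3.111) Steps 1–3. [Kollar2007]
* E. Bierstone, D. Grigoriev, P. Milman, J. Włodarczyk (2011), §4 Step 2b. [BierstoneGrigorievMilmanWlodarczyk2011]
* The Stacks Project, Tags 080A, 080B. [StacksProject]
-/

-- `Summit.<Summit>.<Sub>.Theorems` with `Sub = Summit` (single-conjunct summit, D-0017)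
set_option linter.dupNamespace false

noncomputable section

open CategoryTheory CategoryTheory.Limits AlgebraicGeometry TopologicalSpace IsLocalRing
open Literature.AlgebraicGeometry.Resolution Scheme.IdealSheafData
open Literature.AlgebraicGeometry.Hironaka2017.MonomialPart

namespace Summit.ResolutionOfSingularities.ResolutionOfSingularities.Theorems

universe u

namespace MultiHostCJS

open DepthMultiHost WeightTwoB

/-! ## §1 Transport of the data of a later piece -/

/-- **The stalk of the centre at a point of a piece is the stalk of the piece΄s ideal** (the other pieces are away; the centre is
reduced). [cite: BierstoneGrigorievMilmanWlodarczyk2011, §4 Step 2] -/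
theorem stalkIdeal_vanishingIdeal_piece {E : Scheme.{u}} {K : E.IdealSheafData} (hK : Scheme.IsRegular K.subscheme)
    {Zs : List (Closeds E)} (h : IsPiecePartition K Zs) {Z : Closeds E} (hZ : Z ∈ Zs) {x : E} (hx : x ∈ (Z : Set E)) :
    stalkIdeal (vanishingIdeal Z) x = stalkIdeal K x := by
  obtain ⟨U, hxU, hU⟩ := h.exists_nhd hZ hx
  rw [stalkIdeal_vanishingIdeal_congr (Z' := K.support) U hxU hU, ← eq_vanishingIdeal_support_of_isRegular K hK]

section Loop

variable (hlift : ∀ ⦃X X' : Scheme.{u}⦄ [IsNoetherian X] [IsLocallyNoetherian X'] (S : MultiHostState X)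
    (cyl : CylState S) [IsIntegral cyl.Z] [IsNoetherian cyl.Z] (C : cyl.Z.IdealSheafData), C ≠ ⊥ →
    Scheme.IsRegular C.subscheme → C = vanishingIdeal C.support →
    ∀ (𝓑 : List cyl.Z.IdealSheafData), (∀ T ∈ S.𝓔, T ≠ cyl.j.ker → cyl.bd T ∈ 𝓑) → HasSNCWith 𝓑 C →
    ∀ (τ : X' ⟶ X) (hτ : IsBlowup τ (vanishingIdeal (cyl.centre C))) (η : X), IsGenericPoint η (cyl.centre C : Set X) →
    ∀ (m : Fin S.n → ℕ), (∀ i, cyl.tr i ≤ C ^ m i) → ∀ (ν : ℕ), (∀ i, ν ≤ m i + weightAt (S.exps i) η) →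
    ∃ (hsncX : HasSNCWith S.𝓔 (vanishingIdeal (cyl.centre C)))
      (cyl' : CylState (S.step τ (cyl.centre C) η m ν hsncX hτ)) (τZ : cyl'.Z ⟶ cyl.Z),
      IsBlowup τZ C ∧ cyl'.j ≫ τ = τZ ≫ cyl.j ∧
      cyl'.j.ker = strictTransformIdeal τ (vanishingIdeal (cyl.centre C)) cyl.j.ker ∧
      (∀ i, cyl'.tr i = controlledTransform τZ C (cyl.tr i) (m i)) ∧
      (∀ T ∈ S.𝓔, T ≠ cyl.j.ker →
        cyl'.bd (strictTransformIdeal τ (vanishingIdeal (cyl.centre C)) T) = strictTransformIdeal τZ C (cyl.bd T)) ∧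
      cyl'.bd ((vanishingIdeal (cyl.centre C)).comap τ) = C.comap τZ ∧
      ((cyl'.V : Set X') ⊆ τ ⁻¹' (cyl.V : Set X)) ∧
      (τ ⁻¹' (cyl.V : Set X) \ (cyl'.V : Set X') ⊆
        ((controlledTransform τ (vanishingIdeal (cyl.centre C)) ((C.comap cyl.q).map cyl.V.ι) 1).support : Set X')) ∧
      (∀ T', cyl'.bd T' = T'.comap cyl'.j))


variable (P : ∀ ⦃X : Scheme.{u}⦄ (S : MultiHostState X), CylState S → Prop)
  (hP : ∀ ⦃X X' : Scheme.{u}⦄ [IsLocallyNoetherian X] [IsLocallyNoetherian X'] (S : MultiHostState X)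
    (cyl : CylState S) [IsIntegral cyl.Z] [IsNoetherian cyl.Z] (C : cyl.Z.IdealSheafData), C ≠ ⊥ →
    Scheme.IsRegular C.subscheme → C = vanishingIdeal C.support →
    ∀ (𝓑 : List cyl.Z.IdealSheafData), (∀ T ∈ S.𝓔, T ≠ cyl.j.ker → cyl.bd T ∈ 𝓑) → HasSNCWith 𝓑 C →
    ∀ (D : Closeds cyl.Z), (D : Set cyl.Z) = ⋃ i, ((cyl.tr i).support : Set cyl.Z) →
    vanishingIdeal D ≤ C →
    (∀ x ∈ (C.support : Set cyl.Z),
      ¬ IsRegularLocalRing ((cyl.Z.presheaf.stalk x) ⧸ stalkIdeal (vanishingIdeal D) x) ∨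
        ∃ T ∈ S.𝓔, T ≠ cyl.j.ker ∧ x ∈ ((cyl.bd T).support : Set cyl.Z)) →
    (∀ x ∈ (C.support : Set cyl.Z),
      ((stalkIdeal C x).map (Ideal.Quotient.mk (stalkIdeal (vanishingIdeal D) x))).IsPermissible) →
    ∀ (τ : X' ⟶ X) (hτ : IsBlowup τ (vanishingIdeal (cyl.centre C))) (η : X), IsGenericPoint η (cyl.centre C : Set X) →
    ∀ (m : Fin S.n → ℕ), (∀ i, cyl.tr i ≤ C ^ m i) → (∀ i, ¬ cyl.tr i ≤ C ^ (m i + 1)) →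
    ∀ (hsncX : HasSNCWith S.𝓔 (vanishingIdeal (cyl.centre C)))
      (cyl' : CylState (S.step τ (cyl.centre C) η m 0 hsncX hτ)) (τZ : cyl'.Z ⟶ cyl.Z),
      IsBlowup τZ C → cyl'.j ≫ τ = τZ ≫ cyl.j →
      cyl'.j.ker = strictTransformIdeal τ (vanishingIdeal (cyl.centre C)) cyl.j.ker →
      (∀ i, cyl'.tr i = controlledTransform τZ C (cyl.tr i) (m i)) →
      (∀ T ∈ S.𝓔, T ≠ cyl.j.ker →
        cyl'.bd (strictTransformIdeal τ (vanishingIdeal (cyl.centre C)) T) = strictTransformIdeal τZ C (cyl.bd T)) →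
      cyl'.bd ((vanishingIdeal (cyl.centre C)).comap τ) = C.comap τZ → ((cyl'.V : Set X') ⊆ τ ⁻¹' (cyl.V : Set X)) →
      (τ ⁻¹' (cyl.V : Set X) \ (cyl'.V : Set X') ⊆
        ((controlledTransform τ (vanishingIdeal (cyl.centre C)) ((C.comap cyl.q).map cyl.V.ι) 1).support : Set X')) →
      P S cyl → P (S.step τ (cyl.centre C) η m 0 hsncX hτ) cyl')

include hlift hP

/-- [OURS · L1 W5.2 · F7(β) T2b-X] **ONE CJS CENTRE, jointly** (targets v7), by induction on the number of pieces (`[]` allowed: then the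
given blowing up is along `⊤`, an isomorphism absorbed into `e`).  Given the joint state, a regular E-side centre `C₀` on the carrier with
pieces `Zs` (partition; each irreducible, regular, inside a host trace, snc with the boundary traces), the CJS data of `C₀` w.r.t. the
reduced total host trace `D`, the converse boundary link, and ANY blowing up `τE : E″ → Z` along `C₀`: blowing `X` up piece by piece
(`joint_piece_RP`) yields ONE blowing up supported on the carrier, `X′` regular, `K′ = π^*K`, a cylinder state on `X′` whose carrier is
`≅ E″` over `Z`, the boundary traces linked both ways / snc / preirreducible, the host / boundary bounds and cover relative to
`ρ : Z′ → Z`, the new total host trace `= cl ρ⁻¹(D ∖ V(C₀))`, and `P` carried. [cite: CossartJannsenSaito2020, (6.2)]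
[cite: Kollar2007, (3.111) Steps 1–3] [cite: BierstoneGrigorievMilmanWlodarczyk2011, §4 Step 2b] [cite: StacksProject, Tag 080A] -/
theorem joint_centre_auxRP (n : ℕ) :
    ∀ {X : Scheme.{u}} [IsNoetherian X] (_hX : Scheme.IsRegular X) (S : MultiHostState X) (cyl : CylState S)
      [IsIntegral cyl.Z] [IsNoetherian cyl.Z] (_hZ : Scheme.IsRegular cyl.Z)
      (_hPcyl : P S cyl)
      (𝓑 : List cyl.Z.IdealSheafData) (_hlink : ∀ T ∈ S.𝓔, T ≠ cyl.j.ker → cyl.bd T ∈ 𝓑) (_hsnc𝓑 : HasSNC 𝓑)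
      (_hirr𝓑 : ∀ T ∈ 𝓑, IsPreirreducible (T.support : Set cyl.Z))
      {C₀ : cyl.Z.IdealSheafData} (_hC₀ : Scheme.IsRegular C₀.subscheme)
      {Zs : List (Closeds cyl.Z)} (_hlen : Zs.length = n) (_hP : IsPiecePartition C₀ Zs)
      (_hΓ : ∀ Z ∈ Zs, IsIrreducible (Z : Set cyl.Z) ∧ Scheme.IsRegular (vanishingIdeal Z).subscheme ∧
        (∃ i, (Z : Set cyl.Z) ⊆ (cyl.tr i).support) ∧ HasSNCWith 𝓑 (vanishingIdeal Z))
      {B₀ : Set cyl.Z} (_h𝓑B : ∀ T ∈ 𝓑, (T.support : Set cyl.Z) ⊆ B₀) (_hCB : (C₀.support : Set cyl.Z) ⊆ B₀)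
      (_hcov : ∀ x ∈ B₀, (∃ T ∈ 𝓑, x ∈ T.support) ∨ x ∈ (C₀.support : Set cyl.Z))
      (_hINV : ∀ T' ∈ 𝓑, ∃ T ∈ S.𝓔, T ≠ cyl.j.ker ∧ cyl.bd T = T')
      (D : Closeds cyl.Z) (_hD : (D : Set cyl.Z) = ⋃ i, ((cyl.tr i).support : Set cyl.Z))
      (_hBs : ∀ x ∈ (C₀.support : Set cyl.Z),
        ¬ IsRegularLocalRing ((cyl.Z.presheaf.stalk x) ⧸ stalkIdeal (vanishingIdeal D) x) ∨
          ∃ T ∈ S.𝓔, T ≠ cyl.j.ker ∧ x ∈ ((cyl.bd T).support : Set cyl.Z))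
      (_hpm : ∀ x ∈ (C₀.support : Set cyl.Z),
        ((stalkIdeal C₀ x).map (Ideal.Quotient.mk (stalkIdeal (vanishingIdeal D) x))).IsPermissible)
      {E'' : Scheme.{u}} {τE : E'' ⟶ cyl.Z} (_hτE : IsBlowup τE C₀),
      ∃ (X' : Scheme.{u}) (π : X' ⟶ X) (_ : IsNoetherian X') (S' : MultiHostState X') (cyl' : CylState S')
        (ρ : cyl'.Z ⟶ cyl.Z) (_ : IsIntegral cyl'.Z) (_ : IsNoetherian cyl'.Z) (e : cyl'.Z ≅ E'')
        (𝓑' : List cyl'.Z.IdealSheafData),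
        P S' cyl' ∧ (∃ Q : X.IdealSheafData, IsBlowup π Q ∧ (Q.support : Set X) ⊆ Set.range cyl.j) ∧
        Scheme.IsRegular X' ∧ S'.K = S.K.comap π ∧ S'.n = S.n ∧ cyl'.j ≫ π = ρ ≫ cyl.j ∧ e.hom ≫ τE = ρ ∧
        Scheme.IsRegular cyl'.Z ∧
        (∀ T ∈ S'.𝓔, T ≠ cyl'.j.ker → cyl'.bd T ∈ 𝓑') ∧ HasSNC 𝓑' ∧
        (∀ T' ∈ 𝓑', IsPreirreducible (T'.support : Set cyl'.Z)) ∧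
        (∀ i, ρ ⁻¹' (((cyl.tr i).support : Set cyl.Z) \ (C₀.support : Set cyl.Z)) ⊆ ⋃ i', ((cyl'.tr i').support : Set cyl'.Z)) ∧
        (∀ i', ((cyl'.tr i').support : Set cyl'.Z) ⊆ ρ ⁻¹' ⋃ i, ((cyl.tr i).support : Set cyl.Z)) ∧
        (∀ T' ∈ 𝓑', (T'.support : Set cyl'.Z) ⊆ ρ ⁻¹' B₀) ∧
        (∀ x' : cyl'.Z, ρ x' ∈ B₀ → ∃ T' ∈ 𝓑', x' ∈ T'.support) ∧
        (⋃ i', ((cyl'.tr i').support : Set cyl'.Z)) = closure (ρ ⁻¹' ((D : Set cyl.Z) \ (C₀.support : Set cyl.Z))) ∧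
        (∀ T' ∈ 𝓑', ∃ T ∈ S'.𝓔, T ≠ cyl'.j.ker ∧ cyl'.bd T = T') := by
  induction n with
  | zero =>
    intro X _ hX S cyl _ _ hZ hPcyl 𝓑 hlink hsnc𝓑 hirr𝓑 C₀ hC₀ Zs hlen hPart hΓ B₀ h𝓑B hCB hcov hINV D hD hBs hpm E'' τE hτE
    -- no piece: `C₀ = ⊤`, `τE` is an isomorphism
    have hZs : Zs = [] := List.eq_nil_of_length_eq_zero hlen
    subst hZs
    have hC₀top : C₀ = ⊤ := by
      rw [← prod_pieceIdeals_eq_of_isRegular hC₀ hPart]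
      simp [pieceIdeals, Scheme.IdealSheafData.one_eq_top]
    haveI := isIso_of_isBlowup_top hτE hC₀top
    have hC₀s : (C₀.support : Set cyl.Z) = ∅ := by
      rw [hC₀top, Scheme.IdealSheafData.support_top]; rfl
    refine ⟨X, 𝟙 X, inferInstance, S, cyl, 𝟙 cyl.Z, inferInstance, inferInstance, (asIso τE).symm, 𝓑, hPcyl,
      ⟨⊤, isBlowup_id_top X, by rw [Scheme.IdealSheafData.support_top]; exact fun x hx => absurd hx id⟩, hX,
      by rw [Scheme.IdealSheafData.comap_id], rfl, by rw [Category.comp_id, Category.id_comp],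
      by rw [Iso.symm_hom, asIso_inv, IsIso.inv_hom_id], hZ, hlink, hsnc𝓑, hirr𝓑, fun i x hx => ?_, fun i' x hx => ?_,
      fun T hT x hx => by simpa using h𝓑B T hT hx, fun x hx => ?_, ?_, hINV⟩
    · exact Set.mem_iUnion.mpr ⟨i, hx.1⟩
    · exact Set.mem_iUnion.mpr ⟨i', hx⟩
    · rcases hcov x hx with h | h
      · exact h
      · rw [hC₀s] at h; exact absurd h id
    · have hDc : IsClosed (D : Set cyl.Z) := D.isClosed
      have hpre : (𝟙 cyl.Z : cyl.Z ⟶ cyl.Z) ⁻¹' ((D : Set cyl.Z) \ (C₀.support : Set cyl.Z)) = (D : Set cyl.Z) := by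
        rw [hC₀s, Set.sdiff_empty]
        ext x
        simp only [Set.mem_preimage]
        exact Iff.rfl
      rw [hpre, hDc.closure_eq, hD]
  | succ n ih =>
    intro X _ hX S cyl _ _ hZ hPcyl 𝓑 hlink hsnc𝓑 hirr𝓑 C₀ hC₀ Zs hlen hPart hΓ B₀ h𝓑B hCB hcov hINV D hD hBs hpm E'' τE hτE
    obtain ⟨Z, Zs', rfl⟩ : ∃ Z Zs', Zs = Z :: Zs' := by
      cases Zs with
      | nil => exact absurd hlen (by simp)
      | cons Z Zs' => exact ⟨Z, Zs', rfl⟩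
    have hlen' : Zs'.length = n := by simpa using hlen
    have hZC : (Z : Set cyl.Z) ⊆ (C₀.support : Set cyl.Z) := hPart.subset List.mem_cons_self
    have hZB : (Z : Set cyl.Z) ⊆ B₀ := hZC.trans hCB
    obtain ⟨hirr, hZreg, ⟨i₀, hZi₀⟩, hsncZ⟩ := hΓ Z List.mem_cons_self
    -- FIRST PIECE: the joint piece step
    -- the CJS data of the first piece
    have hBsZ : ∀ x ∈ (Z : Set cyl.Z),
        ¬ IsRegularLocalRing ((cyl.Z.presheaf.stalk x) ⧸ stalkIdeal (vanishingIdeal D) x) ∨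
          ∃ T ∈ S.𝓔, T ≠ cyl.j.ker ∧ x ∈ ((cyl.bd T).support : Set cyl.Z) := fun x hx => hBs x (hZC hx)
    have hpmZ : ∀ x ∈ (Z : Set cyl.Z),
        ((stalkIdeal (vanishingIdeal Z) x).map (Ideal.Quotient.mk (stalkIdeal (vanishingIdeal D) x))).IsPermissible := by
      intro x hx
      rw [stalkIdeal_vanishingIdeal_piece hC₀ hPart List.mem_cons_self hx]
      exact hpm x (hZC hx)
    obtain ⟨X₁, τ₁, hnoethX₁, S₁, cyl₁, τZ, hint₁, hnoeth₁, hP₁, hτ₁, hW₁reg, hW₁j, hX₁, hK₁, hn₁, hτZ, hj₁, hZ₁reg, -, -,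
      hlink₁, hsnc₁, hirr₁, hlow₁, hup₁, hbd₁, hcov₁, hDeq₁, hINV₁⟩ :=
      joint_piece_RP hlift P hP hX S cyl hPcyl hZ 𝓑 hlink hsnc𝓑 hirr𝓑 Z hirr hZreg hZi₀ hsncZ h𝓑B hZB hINV D hD hBsZ hpmZ
    haveI := hnoethX₁
    haveI := hint₁
    haveI := hnoeth₁
    -- the CJS blowing up follows through `τZ`
    obtain ⟨τ₂, hcomp, hτ₂, hC₁reg, hPart₁⟩ := exists_fac_of_isPiecePartition_cons hC₀ hPart hτE hτZ
    -- the data of the remaining pieces, transported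
    set 𝓑₁ : List cyl₁.Z.IdealSheafData :=
      𝓑.map (strictTransformIdeal τZ (vanishingIdeal Z)) ++ [(vanishingIdeal Z).comap τZ] with h𝓑₁
    have hΓ₁ : ∀ Z₁ ∈ Zs'.map (fun W : Closeds cyl.Z => W.preimage τZ.continuous),
        IsIrreducible (Z₁ : Set cyl₁.Z) ∧ Scheme.IsRegular (vanishingIdeal Z₁).subscheme ∧
          (∃ i, (Z₁ : Set cyl₁.Z) ⊆ (cyl₁.tr i).support) ∧ HasSNCWith 𝓑₁ (vanishingIdeal Z₁) := by
      intro Z₁ hZ₁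
      obtain ⟨Z₂, hZ₂, rfl⟩ := List.mem_map.mp hZ₁
      obtain ⟨hirr₂, hZ₂reg, ⟨i₂, hZ₂i⟩, hsnc₂⟩ := hΓ Z₂ (List.mem_cons_of_mem _ hZ₂)
      have hd : Disjoint (Z : Set cyl.Z) Z₂ := hPart.disjoint_of_mem_tail hZ₂
      obtain ⟨hirr₂', hZ₂reg', hsnc₂'⟩ := piece_data_transport hsncZ hτZ hirr₂ hZ₂reg hsnc₂ hd
      refine ⟨hirr₂', hZ₂reg', ?_, hsnc₂'⟩
      -- `τZ⁻¹ Z₂ ⊆ τZ⁻¹(Supp tr i₂ ∖ Z) ⊆ ⋃ Supp tr′`, and irreducible ⇒ inside ONE host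
      refine exists_subset_support_of_subset_iUnion cyl₁.tr hirr₂' fun x hx => hlow₁ i₂ ⟨hZ₂i hx, ?_⟩
      exact Set.disjoint_right.mp hd hx
    have hlen₁ : (Zs'.map (fun W : Closeds cyl.Z => W.preimage τZ.continuous)).length = n := by simpa using hlen'
    -- the remaining centre lies over `⋃ Zs' ⊆ V(C₀) ⊆ B₀`
    set T : Set cyl.Z := ⋃ Z₂ ∈ Zs', (Z₂ : Set cyl.Z) with hT
    have hC₁supp : (((pieceIdeals (Zs'.map fun W : Closeds cyl.Z => W.preimage τZ.continuous)).prod).support : Set cyl₁.Z) =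
        τZ ⁻¹' T := by
      rw [← hPart₁.2, hT]
      ext x
      simp only [List.mem_map, Set.mem_iUnion, exists_prop, Set.mem_preimage]
      constructor
      · rintro ⟨_, ⟨Z₂, hZ₂, rfl⟩, hx⟩
        exact ⟨Z₂, hZ₂, hx⟩
      · rintro ⟨Z₂, hZ₂, hx⟩
        exact ⟨_, ⟨Z₂, hZ₂, rfl⟩, hx⟩
    have hTC : T ⊆ (C₀.support : Set cyl.Z) := by
      rw [← hPart.2, hT]
      exact Set.iUnion₂_subset fun Z₂ hZ₂ =>
        Set.subset_iUnion₂ (s := fun (Z' : Closeds cyl.Z) (_ : Z' ∈ Z :: Zs') => (Z' : Set cyl.Z)) Z₂ (List.mem_cons_of_mem _ hZ₂)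
    have hZT : (Z : Set cyl.Z) ∪ T = (C₀.support : Set cyl.Z) := by
      rw [← hPart.2, hT]
      ext x
      simp only [Set.mem_union, Set.mem_iUnion, List.mem_cons, exists_prop]
      constructor
      · rintro (hx | ⟨Z₂, hZ₂, hx⟩)
        · exact ⟨Z, Or.inl rfl, hx⟩
        · exact ⟨Z₂, Or.inr hZ₂, hx⟩
      · rintro ⟨Z', rfl | hZ', hx⟩
        · exact Or.inl hx
        · exact Or.inr ⟨Z', hZ', hx⟩
    have hCB₁ : (((pieceIdeals (Zs'.map fun W : Closeds cyl.Z => W.preimage τZ.continuous)).prod).support : Set cyl₁.Z) ⊆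
        τZ ⁻¹' B₀ := by
      rw [hC₁supp]; exact Set.preimage_mono (hTC.trans hCB)
    have hcov₁' : ∀ x₁ ∈ τZ ⁻¹' B₀, (∃ T' ∈ 𝓑₁, x₁ ∈ T'.support) ∨
        x₁ ∈ ((((pieceIdeals (Zs'.map fun W : Closeds cyl.Z => W.preimage τZ.continuous)).prod).support : Set cyl₁.Z)) := by
      intro x₁ hx₁
      rcases hcov (τZ x₁) hx₁ with h | h
      · exact Or.inl (hcov₁ x₁ (Or.inl h))
      · rw [← hZT] at h
        rcases h with h | h
        · exact Or.inl (hcov₁ x₁ (Or.inr h))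
        · right; rw [hC₁supp]; exact h
    -- the CJS data of the remaining pieces: carried along `τZ`, an isomorphism near them
    set C₁ : cyl₁.Z.IdealSheafData := (pieceIdeals (Zs'.map fun W : Closeds cyl.Z => W.preimage τZ.continuous)).prod with hC₁def
    let D₁ : Closeds cyl₁.Z := ⟨⋃ i', ((cyl₁.tr i').support : Set cyl₁.Z), isClosed_iUnion_of_finite fun i' => (cyl₁.tr i').support.isClosed⟩
    have hD₁ : (D₁ : Set cyl₁.Z) = ⋃ i', ((cyl₁.tr i').support : Set cyl₁.Z) := rfl
    have hZsupp : (((vanishingIdeal Z).support : Closeds cyl.Z) : Set cyl.Z) = Z := Scheme.IdealSheafData.coe_support_vanishingIdeal Z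
    have hoff : ∀ x₁ : cyl₁.Z, x₁ ∈ (C₁.support : Set cyl₁.Z) → τZ x₁ ∉ ((vanishingIdeal Z).support : Set cyl.Z) ∧
        τZ x₁ ∈ (C₀.support : Set cyl.Z) ∧ ∃ Z₂ ∈ Zs', τZ x₁ ∈ (Z₂ : Set cyl.Z) := by
      intro x₁ hx₁
      rw [hC₁supp, Set.mem_preimage, hT, Set.mem_iUnion₂] at hx₁
      obtain ⟨Z₂, hZ₂, hx₂⟩ := hx₁
      refine ⟨fun h => ?_, hTC (Set.mem_iUnion₂.mpr ⟨Z₂, hZ₂, hx₂⟩), Z₂, hZ₂, hx₂⟩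
      rw [hZsupp] at h
      exact Set.disjoint_iff.mp (hPart.disjoint_of_mem_tail hZ₂) ⟨h, hx₂⟩
    have hD₁stalk : ∀ x₁ : cyl₁.Z, τZ x₁ ∉ ((vanishingIdeal Z).support : Set cyl.Z) →
        stalkIdeal (vanishingIdeal D₁) x₁ = stalkIdeal ((vanishingIdeal D).comap τZ) x₁ := by
      intro x₁ hx₁
      refine stalkIdeal_vanishingIdeal_eq_comap_of_not_mem hτZ hx₁ D D₁ ?_
      rw [hZsupp, hD₁, hDeq₁]
      refine le_antisymm (fun y hy => ?_) fun y hy => ⟨subset_closure hy, fun h => hy.2 h⟩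
      have hcl : closure (τZ ⁻¹' ((D : Set cyl.Z) \ (Z : Set cyl.Z))) ⊆ τZ ⁻¹' (D : Set cyl.Z) :=
        closure_minimal (Set.preimage_mono Set.sdiff_subset) (D.isClosed.preimage τZ.continuous)
      exact ⟨hcl hy.1, hy.2⟩
    have hC₁stalk : ∀ x₁ : cyl₁.Z, x₁ ∈ (C₁.support : Set cyl₁.Z) → stalkIdeal C₁ x₁ = stalkIdeal (C₀.comap τZ) x₁ := by
      intro x₁ hx₁
      obtain ⟨hxZ, -, Z₂, hZ₂, hx₂⟩ := hoff x₁ hx₁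
      haveI := hτZ.isIso_stalkMap_of_not_mem_support hxZ
      have h1 : stalkIdeal C₁ x₁ = stalkIdeal (vanishingIdeal (Z₂.preimage τZ.continuous)) x₁ :=
        (stalkIdeal_vanishingIdeal_piece hC₁reg hPart₁ (List.mem_map.mpr ⟨Z₂, hZ₂, rfl⟩) hx₂).symm
      have h2 : stalkIdeal (vanishingIdeal (Z₂.preimage τZ.continuous)) x₁ = stalkIdeal ((vanishingIdeal Z₂).comap τZ) x₁ :=
        stalkIdeal_vanishingIdeal_eq_comap_of_not_mem hτZ hxZ Z₂ _ (by rw [hZsupp, Closeds.coe_preimage, Set.preimage_sdiff])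
      have h3 : stalkIdeal ((vanishingIdeal Z₂).comap τZ) x₁ = stalkIdeal (C₀.comap τZ) x₁ :=
        (stalkIdeal_comap_eq_iff_of_isIso_stalkMap τZ _ _ x₁).mpr
          (stalkIdeal_vanishingIdeal_piece hC₀ hPart (List.mem_cons_of_mem _ hZ₂) hx₂)
      rw [h1, h2, h3]
    have hpm₁ : ∀ x₁ ∈ (C₁.support : Set cyl₁.Z),
        ((stalkIdeal C₁ x₁).map (Ideal.Quotient.mk (stalkIdeal (vanishingIdeal D₁) x₁))).IsPermissible := by
      intro x₁ hx₁
      obtain ⟨hxZ, hxC, -⟩ := hoff x₁ hx₁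
      haveI := hτZ.isIso_stalkMap_of_not_mem_support hxZ
      rw [hC₁stalk x₁ hx₁, hD₁stalk x₁ hxZ]
      exact isPermissible_stalk_comap τZ x₁ C₀ (vanishingIdeal D) (hpm _ hxC)
    have hBs₁ : ∀ x₁ ∈ (C₁.support : Set cyl₁.Z),
        ¬ IsRegularLocalRing ((cyl₁.Z.presheaf.stalk x₁) ⧸ stalkIdeal (vanishingIdeal D₁) x₁) ∨
          ∃ T ∈ S₁.𝓔, T ≠ cyl₁.j.ker ∧ x₁ ∈ ((cyl₁.bd T).support : Set cyl₁.Z) := by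
      intro x₁ hx₁
      obtain ⟨hxZ, hxC, -⟩ := hoff x₁ hx₁
      rcases hBs _ hxC with h | ⟨T, hT, hne, hxT⟩
      · left
        haveI := hτZ.isIso_stalkMap_of_not_mem_support hxZ
        rw [hD₁stalk x₁ hxZ]
        exact not_isRegularLocalRing_stalk_comap τZ x₁ (vanishingIdeal D) h
      · right
        obtain ⟨T', hT', hxT'⟩ := hcov₁ x₁ (Or.inl ⟨cyl.bd T, hlink T hT hne, hxT⟩)
        obtain ⟨T₁, hT₁, hne₁, hbdT₁⟩ := hINV₁ T' hT'
        exact ⟨T₁, hT₁, hne₁, hbdT₁ ▸ hxT'⟩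
    -- RECURSION on the remaining pieces
    obtain ⟨X', π', hnoethX', S', cyl', ρ', hint', hnoeth', e', 𝓑', hP', ⟨Q', hQ', hQ's⟩, hX', hK', hn', hj', he', hZ'reg,
      hlink', hsnc', hirr', hlow', hup', hbd', hcov', hDeq', hINV'⟩ :=
      ih hX₁ S₁ cyl₁ hZ₁reg hP₁ 𝓑₁ hlink₁ hsnc₁ hirr₁ hC₁reg hlen₁ hPart₁ hΓ₁ hbd₁ hCB₁ hcov₁' hINV₁ D₁ hD₁ hBs₁ hpm₁ hτ₂
    haveI := hnoethX'
    haveI := hint'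
    haveI := hnoeth'
    have hρx : ∀ x' : cyl'.Z, (ρ' ≫ τZ) x' = τZ (ρ' x') := fun x' => by
      simp only [Scheme.Hom.comp_base, TopCat.coe_comp, Function.comp_apply]
    refine ⟨X', π' ≫ τ₁, hnoethX', S', cyl', ρ' ≫ τZ, hint', hnoeth', e', 𝓑', hP', ?_, hX', ?_, hn'.trans hn₁, ?_, ?_, hZ'reg,
      hlink',
      hsnc', hirr', fun i x' hx' => ?_, fun i' x' hx' => ?_, fun T' hT' x' hx' => ?_, fun x' hx' => hcov' x' ?_, ?_, hINV'⟩
    · -- the tower: one blowing up supported on the carrier (Stacks 080B)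
      obtain ⟨Q, hQ, hQs⟩ := IsBlowup.exists_isBlowup_comp_supported τ₁ (vanishingIdeal (cyl.centre (vanishingIdeal Z))) π' Q'
        (Set.range cyl.j) hτ₁ (by rw [Scheme.IdealSheafData.coe_support_vanishingIdeal]; exact hW₁j) hQ'
        (hQ's.trans (by
          rintro x ⟨z, rfl⟩
          change τ₁ (cyl₁.j z) ∈ Set.range cyl.j
          rw [← Scheme.Hom.comp_apply, hj₁, Scheme.Hom.comp_apply]
          exact ⟨τZ z, rfl⟩))
      exact ⟨Q, hQ, hQs⟩
    · rw [hK', hK₁, ← Scheme.IdealSheafData.comap_comp]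
    · rw [← Category.assoc, hj', Category.assoc, hj₁, Category.assoc]
    · rw [← hcomp, ← Category.assoc, he']
    · -- lower bound through the two stages
      rw [Set.mem_preimage, hρx] at hx'
      have hxC : τZ (ρ' x') ∉ (C₀.support : Set cyl.Z) := hx'.2
      rw [← hZT, Set.mem_union, not_or] at hxC
      obtain ⟨i₁, hi₁⟩ := Set.mem_iUnion.mp (hlow₁ i ⟨hx'.1, hxC.1⟩)
      refine hlow' i₁ ⟨hi₁, ?_⟩
      rw [hC₁supp]
      exact hxC.2
    · -- upper bound
      obtain ⟨i₁, hi₁⟩ := Set.mem_iUnion.mp (hup' i' hx')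
      rw [Set.mem_preimage, hρx]
      exact hup₁ i₁ hi₁
    · have h1 := hbd' T' hT' hx'
      rw [Set.mem_preimage, hρx]
      exact h1
    · rw [hρx] at hx'
      exact hx'
    · -- the total host trace: iterated strict transforms (closure calculus)
      have hρ' : IsBlowup ρ' C₁ := by rw [← he']; exact hτ₂.iso_comp e'
      have h1 := closure_preimage_closure_diff hρ' (τZ ⁻¹' ((D : Set cyl.Z) \ (Z : Set cyl.Z)))
      have h2 : ρ' ⁻¹' (τZ ⁻¹' ((D : Set cyl.Z) \ (Z : Set cyl.Z)) \ (C₁.support : Set cyl₁.Z)) =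
          (ρ' ≫ τZ) ⁻¹' ((D : Set cyl.Z) \ (C₀.support : Set cyl.Z)) := by
        rw [hC₁supp, ← hZT]
        ext x'
        simp only [Set.mem_preimage, Set.mem_sdiff, Set.mem_union, hρx, not_or]
        tauto
      rw [hDeq', hD₁, hDeq₁, h1, h2]

end Loop

end MultiHostCJS

end Summit.ResolutionOfSingularities.ResolutionOfSingularities.Theorems

end
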